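import Literature.Analysis.FluidPDE.LocalLerayDifferencePressure
import Literature.Analysis.FluidPDE.LocalLeraySlabGoodSlices
import Literature.Analysis.FluidPDE.LocalLerayDifferenceBalanceSlice
import HarnessLib

/-!
# The weak–strong setting: regularity of almost every time slice

Analysis/FluidPDE theorem file (no new definitions, everything PROVED), on the inline proof path
of the named fact `Literature.Analysis.FluidPDE.local_leray_weak_strong_uniqueness`
(Lemarié-Rieusset 2016, Thm. 14.7). The slice identities of the balance of `|u₁ - u₂|²`
(`LocalLerayDifferenceBalanceSlice.lean`, `LocalLerayCubicRearrangement.lean`) are applied at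
almost every time, where the slices of two local Leray solutions are honest `H¹_loc ∩ L⁶_loc`
divergence-free fields with `L^{3/2}_loc` pressures:

* `WeakStrongSetting.ae_regular_slice` — in the weak–strong setting, for every ball
  `B = B(x₀, ρ)`, for a.e. `s ∈ (0,T)`: `u₁(s), u₂(s)` are measurable and weakly divergence free
  (hence so is `w(s)`), lie in `L³(B(x₀, ρ + 2))` (Kang–Miura–Tsai, a.e. slice) and in `L⁶(B)`
  (Sobolev on the ball), have the weak derivatives `G₁(s), G₂(s) ∈ L²(B)` on `B`
  (slices of the weak spatial gradients, CKN (2.8)–(2.10)), and `p₁(s), p₂(s) ∈ L^{3/2}(B)`.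

## References

* P. G. Lemarié-Rieusset, *The Navier–Stokes Problem in the 21st Century* (2016), Def. 14.1,
  Thm. 14.7. [`LemarieRieusset2016`]
* L. Caffarelli, R. Kohn, L. Nirenberg, Comm. Pure Appl. Math. 35 (1982), (2.8)–(2.10).
  [`CaffarelliKohnNirenberg1982`]
-/

noncomputable section

open MeasureTheory TopologicalSpace Set Filter Topology Function Metric
open scoped ENNReal NNReal RealInnerProductSpace

namespace Literature.Analysis.FluidPDE

namespace LemarieRieusset2016

variable {ν T : ℝ} {u₀ : (EuclideanSpace ℝ (Fin 3)) → (EuclideanSpace ℝ (Fin 3))}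
  {u₁ u₂ : ℝ → (EuclideanSpace ℝ (Fin 3)) → (EuclideanSpace ℝ (Fin 3))}
  {p₁ p₂ : ℝ → (EuclideanSpace ℝ (Fin 3)) → ℝ}
  {u₃ u₄ : ℝ → (EuclideanSpace ℝ (Fin 3)) → (EuclideanSpace ℝ (Fin 3))} {m : ℝ → ℝ} {ε : ℝ}
  {G₁ G₂ : ℝ → (EuclideanSpace ℝ (Fin 3)) → (EuclideanSpace ℝ (Fin 3)) →L[ℝ] (EuclideanSpace ℝ (Fin 3))}

/-! ## Small conversions -/

/-- `|L|²_F ≤ 3 ‖L‖²` on `ℝ³` (private copy of the tree's `frobeniusNormSq_le_three_mul_norm_sq`).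
[folklore] -/
private theorem frobeniusNormSq_le_three_mul_norm_sq' (L : EuclideanSpace ℝ (Fin 3) →L[ℝ] EuclideanSpace ℝ (Fin 3)) :
    frobeniusNormSq L ≤ 3 * ‖L‖ ^ 2 := by
  unfold frobeniusNormSq
  calc ∑ i, ‖L (stdOrthonormalBasis ℝ (EuclideanSpace ℝ (Fin 3)) i)‖ ^ 2
      ≤ ∑ _i : Fin (Module.finrank ℝ (EuclideanSpace ℝ (Fin 3))), ‖L‖ ^ 2 := by
        refine Finset.sum_le_sum fun i _ => ?_
        have h := L.le_opNorm (stdOrthonormalBasis ℝ (EuclideanSpace ℝ (Fin 3)) i)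
        rw [(stdOrthonormalBasis ℝ (EuclideanSpace ℝ (Fin 3))).orthonormal.1 i, mul_one] at h
        exact pow_le_pow_left₀ (norm_nonneg _) h 2
    _ = 3 * ‖L‖ ^ 2 := by
        rw [Finset.sum_const, Finset.card_univ, Fintype.card_fin, finrank_euclideanSpace_fin]
        simp

/-- `ofReal |L|²_F ≤ 3 ‖L‖ₑ²`. [folklore] -/
private theorem ofReal_frobeniusNormSq_le' (L : EuclideanSpace ℝ (Fin 3) →L[ℝ] EuclideanSpace ℝ (Fin 3)) :
    ENNReal.ofReal (frobeniusNormSq L) ≤ 3 * ‖L‖ₑ ^ 2 := by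
  calc ENNReal.ofReal (frobeniusNormSq L) ≤ ENNReal.ofReal (3 * ‖L‖ ^ 2) :=
        ENNReal.ofReal_le_ofReal (frobeniusNormSq_le_three_mul_norm_sq' L)
    _ = 3 * ‖L‖ₑ ^ 2 := by
        rw [ENNReal.ofReal_mul (by norm_num), ENNReal.ofReal_pow (norm_nonneg _), ofReal_norm]
        norm_num

/-- `MemLp f p (μ)` from measurability and `∫⁻ ‖f‖ₑ^p < ∞` (`p = 2, 3, 3/2, 6` …). [folklore] -/
theorem memLp_of_lintegral_rpow_lt_top {α F : Type*} [MeasurableSpace α] {μ : Measure α} [NormedAddCommGroup F]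
    {f : α → F} (hf : AEStronglyMeasurable f μ) {p : ℝ≥0∞} (hp0 : p ≠ 0) (hpt : p ≠ ⊤)
    (h : ∫⁻ x, ‖f x‖ₑ ^ p.toReal ∂μ < ⊤) : MemLp f p μ := by
  refine ⟨hf, ?_⟩
  rw [eLpNorm_eq_lintegral_rpow_enorm_toReal hp0 hpt]
  exact ENNReal.rpow_lt_top_of_nonneg (by positivity) h.ne

/-! ## Almost every slice is regular -/

/-- **Almost every time slice of the weak–strong setting is regular** on a given ball
`B = B(x₀, ρ)`: the slices `u₁(s), u₂(s)` are measurable, weakly divergence free together with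
`w(s) = u₁(s) - u₂(s)`, in `L³(B(x₀, ρ + 2))`, with the weak derivatives `G₁(s), G₂(s) ∈ L²(B)` on
`B`, in `L⁶(B)`, and the pressure slices lie in `L^{3/2}(B)` (Lemarié-Rieusset 2016, Def. 14.1;
CKN (2.8)–(2.10) for the slices of the gradient; Sobolev on the ball). [folklore] -/
theorem WeakStrongSetting.ae_regular_slice (hS : WeakStrongSetting ν T u₀ u₁ u₂ p₁ p₂ u₃ u₄ m ε G₁ G₂)
    (x₀ : EuclideanSpace ℝ (Fin 3)) (ρ : ℝ) :
    ∀ᵐ s ∂(volume.restrict (Ioo 0 T)),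
      AEStronglyMeasurable (u₁ s) volume ∧ AEStronglyMeasurable (u₂ s) volume ∧
      IsWeaklyDivFree (u₁ s) ∧ IsWeaklyDivFree (u₂ s) ∧ IsWeaklyDivFree (fun x => u₁ s x - u₂ s x) ∧
      eLpNorm ((ball x₀ (ρ + 2)).indicator (u₁ s)) 3 volume < ⊤ ∧
      eLpNorm ((ball x₀ (ρ + 2)).indicator (u₂ s)) 3 volume < ⊤ ∧
      FunctionSpaces.HasWeakFDerivOn (⟨ball x₀ ρ, isOpen_ball⟩ : Opens (EuclideanSpace ℝ (Fin 3))) volume (u₁ s) (G₁ s) ∧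
      FunctionSpaces.HasWeakFDerivOn (⟨ball x₀ ρ, isOpen_ball⟩ : Opens (EuclideanSpace ℝ (Fin 3))) volume (u₂ s) (G₂ s) ∧
      MemLp (u₁ s) 6 (volume.restrict (ball x₀ ρ)) ∧ MemLp (u₂ s) 6 (volume.restrict (ball x₀ ρ)) ∧
      MemLp (G₁ s) 2 (volume.restrict (ball x₀ ρ)) ∧ MemLp (G₂ s) 2 (volume.restrict (ball x₀ ρ)) ∧
      MemLp (p₁ s) (3 / 2) (volume.restrict (ball x₀ ρ)) ∧ MemLp (p₂ s) (3 / 2) (volume.restrict (ball x₀ ρ)) := by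
  set B : Set (EuclideanSpace ℝ (Fin 3)) := ball x₀ ρ with hBdef
  set U : Opens (EuclideanSpace ℝ (Fin 3)) := ⟨ball x₀ ρ, isOpen_ball⟩ with hUdef
  haveI hfin : IsFiniteMeasure ((volume : Measure (EuclideanSpace ℝ (Fin 3))).restrict B) :=
    isFiniteMeasure_restrict.2 measure_ball_lt_top.ne
  -- ### divergence-freeness of a.e. slice
  have hab : Ioo (0 : ℝ) T ×ˢ (univ : Set (EuclideanSpace ℝ (Fin 3))) ⊆
      ((slab (EuclideanSpace ℝ (Fin 3)) (Ioo 0 T) isOpen_Ioo : Opens (ℝ × EuclideanSpace ℝ (Fin 3))) :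
        Set (ℝ × EuclideanSpace ℝ (Fin 3))) := by
    rw [coe_slab]
  have hdiv₁ : ∀ᵐ s ∂(volume.restrict (Ioo 0 T)), IsWeaklyDivFree (u₁ s) :=
    (ae_restrict_iff' measurableSet_Ioo).2 (SuitableRestart.ae_isWeaklyDivFree_slice hS.sol₁.suitable hab)
  have hdiv₂ : ∀ᵐ s ∂(volume.restrict (Ioo 0 T)), IsWeaklyDivFree (u₂ s) :=
    (ae_restrict_iff' measurableSet_Ioo).2 (SuitableRestart.ae_isWeaklyDivFree_slice hS.sol₂.suitable hab)
  -- ### the uniformly local energy bounds (for the integrability of `⟨uᵢ(s), ∇θ⟩`)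
  obtain ⟨C₁, hC₁⟩ := hS.sol₁.uniformLocalEnergy 1 one_pos
  obtain ⟨C₂, hC₂⟩ := hS.sol₂.uniformLocalEnergy 1 one_pos
  -- ### Sobolev on the ball
  obtain ⟨CS, hCS⟩ := exists_eLpNorm_six_le_ball_uniform (E := EuclideanSpace ℝ (Fin 3)) finrank_euclideanSpace_fin ρ
  -- ### a ball `B(0, n) ⊇ B`
  obtain ⟨n, hn⟩ := exists_nat_gt (‖x₀‖ + ρ)
  have hBn : B ⊆ ball (0 : EuclideanSpace ℝ (Fin 3)) n := fun x hx => by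
    rw [mem_ball, dist_zero_right]
    rw [mem_ball, dist_eq_norm] at hx
    calc ‖x‖ = ‖(x - x₀) + x₀‖ := by rw [sub_add_cancel]
      _ ≤ ‖x - x₀‖ + ‖x₀‖ := norm_add_le _ _
      _ < n := by linarith
  -- ### the pressures on the compact cylinder `(0,T) × closedBall x₀ ρ`
  have hK : IsCompact (closedBall x₀ ρ) := isCompact_closedBall _ _
  have hPslice : ∀ {π : ℝ → EuclideanSpace ℝ (Fin 3) → ℝ} {v₀' : EuclideanSpace ℝ (Fin 3) → EuclideanSpace ℝ (Fin 3)}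
      {v : ℝ → EuclideanSpace ℝ (Fin 3) → EuclideanSpace ℝ (Fin 3)},
      IsLocalLeraySolutionOn T ν v₀' v π →
      ∀ᵐ s ∂(volume.restrict (Ioo 0 T)), MemLp (π s) (3 / 2) (volume.restrict B) := by
    intro π v₀' v h
    have hInt := h.integrableOn_pressure hK
    set μt : Measure ℝ := volume.restrict (Ioo (0 : ℝ) T) with hμt
    set μK : Measure (EuclideanSpace ℝ (Fin 3)) := volume.restrict (closedBall x₀ ρ) with hμK
    have hprod : μt.prod μK = volume.restrict (Ioo (0 : ℝ) T ×ˢ closedBall x₀ ρ) := by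
      rw [hμt, hμK, Measure.prod_restrict, ← Measure.volume_eq_prod]
    have hπm : AEStronglyMeasurable (uncurry π) (μt.prod μK) := by rw [hprod]; exact hInt.aestronglyMeasurable
    have h32 : AEMeasurable (fun z : ℝ × EuclideanSpace ℝ (Fin 3) => ‖uncurry π z‖ₑ ^ (3 / 2 : ℝ)) (μt.prod μK) :=
      hπm.enorm.pow_const _
    have hfin : ∫⁻ s, ∫⁻ x, ‖π s x‖ₑ ^ (3 / 2 : ℝ) ∂μK ∂μt < ⊤ := by
      have h1 := lintegral_prod _ h32
      simp only [uncurry] at h1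
      rw [← h1, hprod]
      exact h.pressure _ hK
    have hslice_m : ∀ᵐ s ∂μt, AEStronglyMeasurable (π s) μK := by
      have := hπm.prodMk_left
      simpa only [uncurry] using this
    have hslice_f : ∀ᵐ s ∂μt, ∫⁻ x, ‖π s x‖ₑ ^ (3 / 2 : ℝ) ∂μK < ⊤ :=
      ae_lt_top' (h32.lintegral_prod_right') hfin.ne
    filter_upwards [hslice_m, hslice_f] with s hm hf
    have hm' : AEStronglyMeasurable (π s) (volume.restrict B) :=
      hm.mono_measure (Measure.restrict_mono ball_subset_closedBall le_rfl)
    refine memLp_of_lintegral_rpow_lt_top hm' (by norm_num) (ENNReal.div_ne_top (by norm_num) (by norm_num)) ?_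
    have htr : ((3 / 2 : ℝ≥0∞)).toReal = 3 / 2 := by
      rw [ENNReal.toReal_div, ENNReal.toReal_ofNat, ENNReal.toReal_ofNat]
    rw [htr]
    exact lt_of_le_of_lt (lintegral_mono' (Measure.restrict_mono ball_subset_closedBall le_rfl) le_rfl) hf
  -- ### collect
  filter_upwards [hS.ae_slice, hdiv₁, hdiv₂, hC₁, hC₂,
    hS.sol₁.ae_lintegral_cube_ball_lt_top x₀ (ρ + 2), hS.sol₂.ae_lintegral_cube_ball_lt_top x₀ (ρ + 2),
    HasWeakSpatialGradientOn.ae_hasWeakFDerivOn_slice_slab hS.grad₁,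
    HasWeakSpatialGradientOn.ae_hasWeakFDerivOn_slice_slab hS.grad₂,
    hS.sol₁.ae_lintegral_grad_sq_ball_lt_top hS.grad₁, hS.sol₂.ae_lintegral_grad_sq_ball_lt_top hS.grad₂,
    hPslice hS.sol₁, hPslice hS.sol₂] with s hsl hd₁ hd₂ hA₁ hA₂ h3₁ h3₂ hW₁ hW₂ hG₁n hG₂n hP₁ hP₂
  obtain ⟨hm₁, hm₂, -, -, -, -, -⟩ := hsl
  -- divergence-freeness of `w(s)`
  have hAt : (max (C₁ : ℝ≥0∞) C₂) ≠ ⊤ := by simp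
  have hA₁' : ∀ z, ∫⁻ y in ball z 1, ‖u₁ s y‖ₑ ^ 2 ≤ max (C₁ : ℝ≥0∞) C₂ := fun z => (hA₁ z).trans (le_max_left _ _)
  have hA₂' : ∀ z, ∫⁻ y in ball z 1, ‖u₂ s y‖ₑ ^ 2 ≤ max (C₁ : ℝ≥0∞) C₂ := fun z => (hA₂ z).trans (le_max_right _ _)
  have hdw : IsWeaklyDivFree fun x => u₁ s x - u₂ s x := by
    intro θ hθ
    have i₁ := integrable_inner_gradient_of_uloc hm₁ hAt hA₁' hθ
    have i₂ := integrable_inner_gradient_of_uloc hm₂ hAt hA₂' hθ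
    have e : (fun x => ⟪u₁ s x - u₂ s x, gradient θ x⟫) = fun x => ⟪u₁ s x, gradient θ x⟫ - ⟪u₂ s x, gradient θ x⟫ :=
      funext fun x => inner_sub_left _ _ _
    rw [e, integral_sub i₁ i₂, hd₁ θ hθ, hd₂ θ hθ, sub_zero]
  -- `L³` on `B(x₀, ρ + 2)`
  have hL3 : ∀ {v : EuclideanSpace ℝ (Fin 3) → EuclideanSpace ℝ (Fin 3)}, AEStronglyMeasurable v volume →
      ∫⁻ y in ball x₀ (ρ + 2), ‖v y‖ₑ ^ (3 : ℕ) < ⊤ → eLpNorm ((ball x₀ (ρ + 2)).indicator v) 3 volume < ⊤ := by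
    intro v hv h3
    rw [eLpNorm_indicator_eq_eLpNorm_restrict measurableSet_ball,
      eLpNorm_eq_lintegral_rpow_enorm_toReal (by norm_num) ENNReal.ofNat_ne_top, ENNReal.toReal_ofNat]
    refine ENNReal.rpow_lt_top_of_nonneg (by positivity) (ne_of_lt ?_)
    have e : (fun y => ‖v y‖ₑ ^ (3 : ℝ)) = fun y => ‖v y‖ₑ ^ (3 : ℕ) := by
      funext y; rw [show (3 : ℝ) = ((3 : ℕ) : ℝ) by norm_num, ENNReal.rpow_natCast]
    rw [e]
    exact h3
  -- weak derivatives on the ball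
  have hWB₁ : FunctionSpaces.HasWeakFDerivOn U volume (u₁ s) (G₁ s) :=
    FunctionSpaces.HasWeakFDerivOn.mono_set_holds hW₁ le_top
  have hWB₂ : FunctionSpaces.HasWeakFDerivOn U volume (u₂ s) (G₂ s) :=
    FunctionSpaces.HasWeakFDerivOn.mono_set_holds hW₂ le_top
  -- `Gᵢ(s) ∈ L²(B)`
  have hGL2 : ∀ {G : EuclideanSpace ℝ (Fin 3) → EuclideanSpace ℝ (Fin 3) →L[ℝ] EuclideanSpace ℝ (Fin 3)}
      {v : EuclideanSpace ℝ (Fin 3) → EuclideanSpace ℝ (Fin 3)},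
      FunctionSpaces.HasWeakFDerivOn U volume v G →
      (∫⁻ x in ball (0 : EuclideanSpace ℝ (Fin 3)) n, ‖G x‖ₑ ^ 2 < ⊤) → MemLp G 2 (volume.restrict B) := by
    intro G v hW hGn
    have hm : AEStronglyMeasurable G (volume.restrict B) := hW.locallyIntegrableOn_deriv.aestronglyMeasurable
    refine memLp_of_lintegral_rpow_lt_top hm two_ne_zero ENNReal.ofNat_ne_top ?_
    rw [ENNReal.toReal_ofNat]
    have e : (fun y => ‖G y‖ₑ ^ (2 : ℝ)) = fun y => ‖G y‖ₑ ^ (2 : ℕ) := by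
      funext y; rw [show (2 : ℝ) = ((2 : ℕ) : ℝ) by norm_num, ENNReal.rpow_natCast]
    rw [e]
    exact lt_of_le_of_lt (lintegral_mono' (Measure.restrict_mono hBn le_rfl) le_rfl) hGn
  have hGB₁ := hGL2 hWB₁ (hG₁n n)
  have hGB₂ := hGL2 hWB₂ (hG₂n n)
  -- `uᵢ(s) ∈ L³(B) ⊂ L²(B)`, then `L⁶(B)` by Sobolev
  have hL3₁ := hL3 hm₁ h3₁
  have hL3₂ := hL3 hm₂ h3₂
  have hL6 : ∀ {G : EuclideanSpace ℝ (Fin 3) → EuclideanSpace ℝ (Fin 3) →L[ℝ] EuclideanSpace ℝ (Fin 3)}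
      {v : EuclideanSpace ℝ (Fin 3) → EuclideanSpace ℝ (Fin 3)}, AEStronglyMeasurable v volume →
      FunctionSpaces.HasWeakFDerivOn U volume v G → eLpNorm ((ball x₀ (ρ + 2)).indicator v) 3 volume < ⊤ →
      MemLp G 2 (volume.restrict B) → MemLp v 6 (volume.restrict B) := by
    intro G v hvm hW hv3 hG
    have hv3' : MemLp v 3 (volume.restrict B) := memLp_three_ball_of_indicator' hvm hv3
    have hv2 : MemLp v 2 (volume.restrict B) := hv3'.mono_exponent (by norm_num)
    have hfrob : (∫⁻ x in B, ENNReal.ofReal (frobeniusNormSq (G x))) < ⊤ := by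
      calc (∫⁻ x in B, ENNReal.ofReal (frobeniusNormSq (G x))) ≤ ∫⁻ x in B, 3 * ‖G x‖ₑ ^ 2 :=
            lintegral_mono fun x => ofReal_frobeniusNormSq_le' _
        _ = 3 * ∫⁻ x in B, ‖G x‖ₑ ^ 2 := lintegral_const_mul' _ _ (by norm_num)
        _ < ⊤ := by
            refine ENNReal.mul_lt_top (by norm_num) ?_
            have h := hG.2
            rw [eLpNorm_eq_lintegral_rpow_enorm_toReal two_ne_zero ENNReal.ofNat_ne_top, ENNReal.toReal_ofNat] at h
            have h' : (∫⁻ x in B, ‖G x‖ₑ ^ (2 : ℝ)) < ⊤ := by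
              by_contra hc
              rw [not_lt, top_le_iff] at hc
              rw [hc, ENNReal.top_rpow_of_pos (by norm_num)] at h
              exact lt_irrefl _ h
            have e : (fun y => ‖G y‖ₑ ^ (2 : ℝ)) = fun y => ‖G y‖ₑ ^ (2 : ℕ) := by
              funext y; rw [show (2 : ℝ) = ((2 : ℕ) : ℝ) by norm_num, ENNReal.rpow_natCast]
            rwa [e] at h'
    have h6 := hCS x₀ v G hW hv2.2.ne
    refine ⟨hv2.1, lt_of_le_of_lt h6 ?_⟩
    refine ENNReal.mul_lt_top ENNReal.coe_lt_top (ENNReal.add_lt_top.2 ⟨hv2.2, ?_⟩)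
    exact ENNReal.rpow_lt_top_of_nonneg (by norm_num) hfrob.ne
  exact ⟨hm₁, hm₂, hd₁, hd₂, hdw, hL3₁, hL3₂, hWB₁, hWB₂, hL6 hm₁ hWB₁ hL3₁ hGB₁, hL6 hm₂ hWB₂ hL3₂ hGB₂,
    hGB₁, hGB₂, hP₁, hP₂⟩

end LemarieRieusset2016

end Literature.Analysis.FluidPDE
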